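import Literature.Probability.LatticeModels.InterfaceTouching
import Literature.Probability.LatticeModels.MaxAxisComparison
import Literature.Probability.LatticeModels.LastAxisSite
import Literature.Probability.LatticeModels.OrientationTail
import Literature.Probability.LatticeModels.BadPercolationEnclosure
import Literature.Probability.LatticeModels.AizenmanHiguchiAssembly
import HarnessLib

/-!
# Good crossings in the coexistence case (a contour-free Case 3 of Georgii–Higuchi 2000, Lemma 5.5)

Topic `Probability/LatticeModels`; theorems only. Georgii–Higuchi, J. Math. Phys. 41 (2000), proof of
Lemma 5.5, Case 3 ("`μ(E⁺_up) = μ(E⁻_up) = 1`"): "By the pinning lemma and the independence of the two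
layers, the following event has `ν̂`-probability at least `(θ/4)²`: in the first layer, `y` is
`-∗`connected off `Δ` to `I^-_up(ω)` …; in the second layer, `x` is `+∗`connected off `Δ` to
`I^{+∗}_up(ω̂)` … Since `γ_up(ω)` and `γ_up(ω̂)` intersect each other infinitely often by Lemma 5.4, the
union of `p_y^-(ω)` and `p_x^+(ω̂)` contains a `∗`path from `x` to `y` which is a `≤∗`path for the
duplicated system."

We replace the contours `γ_up` and Lemma 5.4 by the comparison of the last axis sites of the infinite
`+∗`clusters of the two layers (`MaxAxisComparison`, `LastAxisSite`) and the touching criterion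
(`InterfaceTouching`), and the independence of the layers by their positive correlations
(`prod_measureReal_inter_ge_of_antitone_monotone`): for a tail-trivial `μ ∈ 𝒢(β, 0)`, `β > β_c(2)`, under
which the upper half-plane contains an infinite `+∗`cluster touching the axis on the left outside every
box and an infinite `-`cluster, and its horizontal unit translate `μ̂`, **if `x` on the left is pinned
to the infinite `+∗`cluster in the second layer and `y` on the right is pinned to the infinite `-`cluster
in the first layer with probabilities `≥ c_P` (by walks avoiding a band below the axis), then with
`μ ⊗ μ̂`-probability at least `c₀ c_P²` there is a `∗`-walk of good sites from `x` to `y` avoiding the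
band** (`le_measureReal_goodWalk_of_pinning`), `c₀ = (1 - (1 + δ₀)⁻¹)/2`, `δ₀ = e^{-8|β|}/2`. The
pinning probabilities are hypotheses (Georgii–Higuchi's Lemma 5.2); `x, y` are arbitrary sites.

## References

* H.-O. Georgii, Y. Higuchi, J. Math. Phys. 41 (2000) 1153–1169, Lemma 5.5, proof, Case 3 (p. 15)
  [GeorgiiHiguchi2000].
-/

noncomputable section

open MeasureTheory Filter SimpleGraph
open Literature.Probability.Percolation
open scoped ENNReal

namespace Literature.Probability.LatticeModels

/-! ### The pinning events and the good-walk event -/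

section Events

/-- An event of spin configurations decided by the spins in a finite set is measurable. [folklore] -/
theorem measurableSet_of_forall_eq_config {K : Finset (Site 2)} {A : Set (SpinConfig (Site 2))}
    (h : ∀ ω ω' : SpinConfig (Site 2), (∀ x ∈ K, ω x = ω' x) → (ω ∈ A ↔ ω' ∈ A)) : MeasurableSet A :=
  cylinderEvents_le_pi _ (measurableSet_cylinderEvents_of_forall_eq h)

/-- The event "a `∗`-walk of `s`-sites satisfying `Q` joins `x` to `z`" is measurable. [folklore] -/
theorem measurableSet_exists_spinWalk (s : ℤˣ) (x z : Site 2) (Q : Site 2 → Prop) :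
    MeasurableSet {ω : SpinConfig (Site 2) | ∃ w : zdStarGraph.Walk x z, ∀ v ∈ w.support, ω v = s ∧ Q v} := by
  have hE : {ω : SpinConfig (Site 2) | ∃ w : zdStarGraph.Walk x z, ∀ v ∈ w.support, ω v = s ∧ Q v} =
      ⋃ N : ℕ, {ω | ∃ w : zdStarGraph.Walk x z, (∀ v ∈ w.support, v ∈ box 2 N) ∧ ∀ v ∈ w.support, ω v = s ∧ Q v} := by
    ext ω
    simp only [Set.mem_setOf_eq, Set.mem_iUnion]
    constructor
    · rintro ⟨w, hw⟩
      obtain ⟨N, hN⟩ := (eventually_subset_box_holds (d := 2) w.support.toFinset).exists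
      exact ⟨N, w, fun v hv => hN (List.mem_toFinset.2 hv), hw⟩
    · rintro ⟨N, w, -, hw⟩; exact ⟨w, hw⟩
  rw [hE]
  refine MeasurableSet.iUnion fun N => measurableSet_of_forall_eq_config (K := box 2 N) fun ω ω' hωω' => ?_
  constructor
  · rintro ⟨w, hwN, hw⟩; exact ⟨w, hwN, fun v hv => by rw [← hωω' v (hwN v hv)]; exact hw v hv⟩
  · rintro ⟨w, hwN, hw⟩; exact ⟨w, hwN, fun v hv => by rw [hωω' v (hwN v hv)]; exact hw v hv⟩

/-- **The `+`pinning event is measurable**: "`x` is joined by a `∗`-walk of `+`sites satisfying `Q` to a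
site of an infinite `+∗`cluster of the upper half-plane". [folklore] -/
theorem measurableSet_plusPin (x : Site 2) (Q : Site 2 → Prop) :
    MeasurableSet {ω : SpinConfig (Site 2) | ∃ z, (siteCluster zdStarGraph (spinSites 1 ω ∩ halfPlane 0) z).Infinite ∧
      ∃ w : zdStarGraph.Walk x z, ∀ v ∈ w.support, ω v = 1 ∧ Q v} := by
  have : {ω : SpinConfig (Site 2) | ∃ z, (siteCluster zdStarGraph (spinSites 1 ω ∩ halfPlane 0) z).Infinite ∧
      ∃ w : zdStarGraph.Walk x z, ∀ v ∈ w.support, ω v = 1 ∧ Q v} =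
      ⋃ z, {ω | (siteCluster zdStarGraph (spinSites 1 ω ∩ halfPlane 0) z).Infinite} ∩
        {ω | ∃ w : zdStarGraph.Walk x z, ∀ v ∈ w.support, ω v = 1 ∧ Q v} := by
    ext ω; simp
  rw [this]
  exact MeasurableSet.iUnion fun z => (measurableSet_infinite_plusStarCluster z).inter (measurableSet_exists_spinWalk 1 x z Q)

/-- The event "the `-`cluster of the upper half-plane through `z` is infinite" is measurable. [folklore] -/
theorem measurableSet_infinite_minusCluster (z : Site 2) :
    MeasurableSet {ω : SpinConfig (Site 2) | (siteCluster (zdGraph 2) (spinSites (-1) ω ∩ halfPlane 0) z).Infinite} := by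
  classical
  exact measurable_spinSites_inter_halfPlane (-1) (measurableSet_sitePercolatesAt (G := zdGraph 2) z)

/-- **The `-`pinning event is measurable.** [folklore] -/
theorem measurableSet_minusPin (y : Site 2) (Q : Site 2 → Prop) :
    MeasurableSet {ω : SpinConfig (Site 2) | ∃ z, (siteCluster (zdGraph 2) (spinSites (-1) ω ∩ halfPlane 0) z).Infinite ∧
      ∃ w : zdStarGraph.Walk y z, ∀ v ∈ w.support, ω v = -1 ∧ Q v} := by
  have : {ω : SpinConfig (Site 2) | ∃ z, (siteCluster (zdGraph 2) (spinSites (-1) ω ∩ halfPlane 0) z).Infinite ∧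
      ∃ w : zdStarGraph.Walk y z, ∀ v ∈ w.support, ω v = -1 ∧ Q v} =
      ⋃ z, {ω | (siteCluster (zdGraph 2) (spinSites (-1) ω ∩ halfPlane 0) z).Infinite} ∩
        {ω | ∃ w : zdStarGraph.Walk y z, ∀ v ∈ w.support, ω v = -1 ∧ Q v} := by
    ext ω; simp
  rw [this]
  exact MeasurableSet.iUnion fun z => (measurableSet_infinite_minusCluster z).inter (measurableSet_exists_spinWalk (-1) y z Q)

/-- The `+`pinning event is increasing. [folklore] -/
theorem plusPin_mono {x : Site 2} {Q : Site 2 → Prop} {ω ω' : SpinConfig (Site 2)} (h : ω ≤ ω')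
    (hω : ∃ z, (siteCluster zdStarGraph (spinSites 1 ω ∩ halfPlane 0) z).Infinite ∧
      ∃ w : zdStarGraph.Walk x z, ∀ v ∈ w.support, ω v = 1 ∧ Q v) :
    ∃ z, (siteCluster zdStarGraph (spinSites 1 ω' ∩ halfPlane 0) z).Infinite ∧
      ∃ w : zdStarGraph.Walk x z, ∀ v ∈ w.support, ω' v = 1 ∧ Q v := by
  obtain ⟨z, hinf, w, hw⟩ := hω
  refine ⟨z, hinf.mono (siteCluster_mono (Set.inter_subset_inter_left _ (spinSites_one_mono h)) _), w, fun v hv => ⟨?_, (hw v hv).2⟩⟩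
  exact spinSites_one_mono h (hw v hv).1

/-- The `-`pinning event is decreasing. [folklore] -/
theorem minusPin_anti {y : Site 2} {Q : Site 2 → Prop} {ω ω' : SpinConfig (Site 2)} (h : ω' ≤ ω)
    (hω : ∃ z, (siteCluster (zdGraph 2) (spinSites (-1) ω ∩ halfPlane 0) z).Infinite ∧
      ∃ w : zdStarGraph.Walk y z, ∀ v ∈ w.support, ω v = -1 ∧ Q v) :
    ∃ z, (siteCluster (zdGraph 2) (spinSites (-1) ω' ∩ halfPlane 0) z).Infinite ∧
      ∃ w : zdStarGraph.Walk y z, ∀ v ∈ w.support, ω' v = -1 ∧ Q v := by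
  have hneg : spinSites (-1) ω ⊆ spinSites (-1) ω' := fun v hv => by
    rw [mem_spinSites] at hv ⊢
    have := h v
    rw [hv] at this
    exact le_antisymm this (neg_one_le_intUnits _)
  obtain ⟨z, hinf, w, hw⟩ := hω
  exact ⟨z, hinf.mono (siteCluster_mono (Set.inter_subset_inter_left _ hneg) _), w, fun v hv => ⟨hneg (hw v hv).1, (hw v hv).2⟩⟩

end Events

/-! ### Horizontal shifts of the almost-sure hypotheses -/

section ShiftAE

/-- An infinite `-`cluster of the upper half-plane exists for `θ_{s e₁} ω` iff it does for `ω`. [folklore] -/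
theorem exists_infinite_minusCluster_configShift_iff (s : ℤ) (ω : SpinConfig (Site 2)) :
    (∃ y, (siteCluster (zdGraph 2) (spinSites (-1) (configShift (Pi.single 0 s) ω) ∩ halfPlane 0) y).Infinite) ↔
      ∃ y, (siteCluster (zdGraph 2) (spinSites (-1) ω ∩ halfPlane 0) y).Infinite := by
  set φ := zdShiftIso (d := 2) (Pi.single 0 s) with hφ
  have hcfg : (configShift (S := ℤˣ) (Pi.single 0 s) ω : SpinConfig (Site 2)) = configRelabel φ.toEquiv ω := rfl
  have himg : (φ : Site 2 → Site 2) '' (spinSites (-1) ω ∩ halfPlane 0) = (φ : Site 2 → Site 2) '' spinSites (-1) ω ∩ halfPlane 0 := by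
    ext z
    simp only [Set.mem_image, Set.mem_inter_iff, halfPlane, Set.mem_setOf_eq, hφ, zdShiftIso_apply]
    constructor
    · rintro ⟨y, ⟨hy, hy1⟩, rfl⟩; exact ⟨⟨y, hy, rfl⟩, by simpa using hy1⟩
    · rintro ⟨⟨y, hy, rfl⟩, hz1⟩; exact ⟨y, ⟨hy, by simpa using hz1⟩, rfl⟩
  have hO : spinSites (-1) (configShift (S := ℤˣ) (Pi.single 0 s) ω) ∩ halfPlane 0 =
      (φ : Site 2 → Site 2) '' (spinSites (-1) ω ∩ halfPlane 0) := by
    rw [hcfg, spinSites_configRelabel, himg]; rfl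
  have key : ∀ y : Site 2, siteCluster (zdGraph 2) ((φ : Site 2 → Site 2) '' (spinSites (-1) ω ∩ halfPlane 0)) (φ y) =
      (φ : Site 2 → Site 2) '' siteCluster (zdGraph 2) (spinSites (-1) ω ∩ halfPlane 0) y := fun y => by
    have h := siteCluster_relabel φ (spinSites (-1) ω ∩ halfPlane 0) y
    rwa [SiteConfig.relabel_apply] at h
  rw [hO]
  constructor
  · rintro ⟨y, hy⟩
    refine ⟨φ.symm y, ?_⟩
    have hk := key (φ.symm y)
    rw [RelIso.apply_symm_apply] at hk
    rw [hk] at hy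
    exact Set.Infinite.of_image _ hy
  · rintro ⟨y, hy⟩
    exact ⟨φ y, by rw [key]; exact hy.image φ.injective.injOn⟩

/-- The almost-sure existence of an infinite `-`cluster passes to the horizontal translate. [folklore] -/
theorem ae_exists_infinite_minusCluster_map_configShift {μ : Measure (SpinConfig (Site 2))} (s : ℤ)
    (h : ∀ᵐ ω ∂μ, ∃ y, (siteCluster (zdGraph 2) (spinSites (-1) ω ∩ halfPlane 0) y).Infinite) :
    ∀ᵐ ω ∂(μ.map (configShift (Pi.single 0 s))), ∃ y, (siteCluster (zdGraph 2) (spinSites (-1) ω ∩ halfPlane 0) y).Infinite := by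
  classical
  have hmeas : MeasurableSet {ω : SpinConfig (Site 2) | ∃ y, (siteCluster (zdGraph 2) (spinSites (-1) ω ∩ halfPlane 0) y).Infinite} :=
    MeasurableSet.of_tailEvents (measurableSet_tailEvents_existsInfClusterIn (G := zdGraph 2) (-1) (halfPlane 0))
  rw [ae_map_iff (configShift _).measurable.aemeasurable hmeas]
  filter_upwards [h] with ω hω
  exact (exists_infinite_minusCluster_configShift_iff s ω).2 hω

end ShiftAE

/-! ### The main estimate -/

section Main

variable {β : ℝ} {μ : Measure (SpinConfig (Site 2))}

/-- **Good crossings in the coexistence case, from pinning** (our form of Georgii–Higuchi 2000,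
Lemma 5.5, Case 3). Let `β > β_c(2)`, `μ ∈ 𝒢(β, 0)` tail trivial, `s = ±1`, `μ̂ = μ ∘ θ_{s e₁}⁻¹`; assume
that `μ`-almost surely the upper half-plane contains an infinite `-`cluster and a `+∗`cluster with axis
sites unbounded below (the orientation "`+`face on the left"). Let `Q` be any constraint on sites (the
complement of a band) satisfied by every site of the closed upper half-plane, `x, y` two sites, and
suppose the pinning bounds: with `μ̂`-probability `≥ c_P`, `x` is joined by a `∗`-walk of `+`sites
satisfying `Q` to an infinite `+∗`cluster of the upper half-plane, and with `μ`-probability `≥ c_P`, `y`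
is joined by a `∗`-walk of `-`sites satisfying `Q` to an infinite `-`cluster of the upper half-plane.
Then with `μ ⊗ μ̂`-probability at least `c₀ c_P²`, `c₀ = (1 - (1 + e^{-8|β|}/2)⁻¹)/2`, there is a
`∗`-walk from `x` to `y` all of whose sites are good (`ω v ≤ ω̂ v`) and satisfy `Q`. [cite: GeorgiiHiguchi2000, Lemma 5.5 (proof, Case 3, p. 15)] -/
theorem le_measureReal_goodWalk_of_pinning (hβc : criticalBeta 2 < β) (hμ : μ ∈ isingGibbsMeasures 2 β 0)
    (hμt : IsTailTrivial μ) (s : ℤˣ)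
    (hL : ∀ᵐ ω ∂μ, ∃ x, ∀ n : ℕ, ∃ k : ℤ, k < -(n : ℤ) ∧
      (![k, 0] : Site 2) ∈ siteCluster zdStarGraph (spinSites 1 ω ∩ halfPlane 0) x)
    (hC : ∀ᵐ ω ∂μ, ∃ y, (siteCluster (zdGraph 2) (spinSites (-1) ω ∩ halfPlane 0) y).Infinite)
    {Q : Site 2 → Prop} (hQ : ∀ v : Site 2, 0 ≤ v 1 → Q v) (x y : Site 2) {cP : ℝ}
    (hpinx : cP ≤ (μ.map (configShift (Pi.single 0 (s : ℤ)))).real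
      {ω : SpinConfig (Site 2) | ∃ z, (siteCluster zdStarGraph (spinSites 1 ω ∩ halfPlane 0) z).Infinite ∧
        ∃ w : zdStarGraph.Walk x z, ∀ v ∈ w.support, ω v = 1 ∧ Q v})
    (hpiny : cP ≤ μ.real
      {ω : SpinConfig (Site 2) | ∃ z, (siteCluster (zdGraph 2) (spinSites (-1) ω ∩ halfPlane 0) z).Infinite ∧
        ∃ w : zdStarGraph.Walk y z, ∀ v ∈ w.support, ω v = -1 ∧ Q v})
    (hcP : 0 ≤ cP) :
    ((1 - (1 + ENNReal.ofReal (Real.exp (-(8 * |β|)) / 2))⁻¹) / 2).toReal * cP * cP ≤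
      (μ.prod (μ.map (configShift (Pi.single 0 (s : ℤ))))).real
        {p : SpinConfig (Site 2) × SpinConfig (Site 2) | ∃ w : zdStarGraph.Walk x y,
          ∀ v ∈ w.support, p.1 v ≤ p.2 v ∧ Q v} := by
  classical
  have hβ : 0 ≤ β := (criticalBeta_nonneg 2).trans hβc.le
  have hμG : IsGibbsMeasure (isingSpecification (zdGraph 2) β 0) μ := hμ
  haveI := hμG.isProbabilityMeasure
  set T : SpinConfig (Site 2) → SpinConfig (Site 2) := ⇑(configShift (S := ℤˣ) (Pi.single (0 : Fin 2) (s : ℤ))) with hT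
  set μ' : Measure (SpinConfig (Site 2)) := μ.map T with hμ'
  have hμ'G : μ' ∈ isingGibbsMeasures 2 β 0 := mem_isingGibbsMeasures_map_configShift hμ _
  have hμ'GG : IsGibbsMeasure (isingSpecification (zdGraph 2) β 0) μ' := hμ'G
  haveI : IsProbabilityMeasure μ' := hμ'GG.isProbabilityMeasure
  have hμ't : IsTailTrivial μ' := hμt.map_configRelabel (Site.shift _)
  -- the events
  set R : ℤ → Set (SpinConfig (Site 2)) := fun j =>
    {ω : SpinConfig (Site 2) | ∃ k : ℤ, j ≤ k ∧ (siteCluster zdStarGraph (spinSites 1 ω ∩ halfPlane 0) ![k, 0]).Infinite} with hR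
  set Cmp := {p : SpinConfig (Site 2) × SpinConfig (Site 2) | ∃ j : ℤ, p.1 ∉ R (j + 1) ∧ p.2 ∈ R j} with hCmp
  set Px := {ω : SpinConfig (Site 2) | ∃ z, (siteCluster zdStarGraph (spinSites 1 ω ∩ halfPlane 0) z).Infinite ∧
    ∃ w : zdStarGraph.Walk x z, ∀ v ∈ w.support, ω v = 1 ∧ Q v} with hPx
  set Py := {ω : SpinConfig (Site 2) | ∃ z, (siteCluster (zdGraph 2) (spinSites (-1) ω ∩ halfPlane 0) z).Infinite ∧
    ∃ w : zdStarGraph.Walk y z, ∀ v ∈ w.support, ω v = -1 ∧ Q v} with hPy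
  set U := {p : SpinConfig (Site 2) × SpinConfig (Site 2) | ∃ w : zdStarGraph.Walk x y,
    ∀ v ∈ w.support, p.1 v ≤ p.2 v ∧ Q v} with hU
  have hCmpm : MeasurableSet Cmp := by
    have : Cmp = ⋃ j : ℤ, (R (j + 1))ᶜ ×ˢ R j := by ext p; simp [hCmp, Set.mem_prod]
    rw [this]
    exact MeasurableSet.iUnion fun j => (measurableSet_axisReach (j + 1)).compl.prod (measurableSet_axisReach j)
  have hPxm : MeasurableSet Px := measurableSet_plusPin x Q
  have hPym : MeasurableSet Py := measurableSet_minusPin y Q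
  -- (1) the comparison event has probability `≥ c₀`
  have hexists : ∀ᵐ ω ∂μ, ∃ j : ℤ, ω ∈ R j \ R (j + 1) := by
    filter_upwards [ae_exists_lastAxisSite hβc hμ, hL, hC] with ω h hLω hCω
    exact h hLω hCω
  have h1 : (1 - (1 + ENNReal.ofReal (Real.exp (-(8 * |β|)) / 2))⁻¹) / 2 ≤ (μ.prod μ') Cmp :=
    le_measure_axisReach_shift hμ hexists s
  -- (2) positive correlations: `ν(Cmp ∩ (Py × Px)) ≥ ν(Cmp) μ(Py) μ'(Px)`
  have hanti : ∀ {j j' : ℤ} {ω}, j ≤ j' → ω ∈ R j' → ω ∈ R j := fun hjj' h => axisReach_anti hjj' h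
  have hCmp_mono : ∀ p q : SpinConfig (Site 2) × SpinConfig (Site 2), q.1 ≤ p.1 → p.2 ≤ q.2 → p ∈ Cmp → q ∈ Cmp := by
    rintro p q h1 h2 ⟨j, hp1, hp2⟩
    exact ⟨j, fun hq => hp1 (axisReach_mono_config h1 hq), axisReach_mono_config h2 hp2⟩
  set PxPair := {p : SpinConfig (Site 2) × SpinConfig (Site 2) | p.2 ∈ Px} with hPxPair
  set PyPair := {p : SpinConfig (Site 2) × SpinConfig (Site 2) | p.1 ∈ Py} with hPyPair
  have hPxPairm : MeasurableSet PxPair := measurable_snd hPxm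
  have hPyPairm : MeasurableSet PyPair := measurable_fst hPym
  have hPx_mono : ∀ p q : SpinConfig (Site 2) × SpinConfig (Site 2), q.1 ≤ p.1 → p.2 ≤ q.2 → p ∈ PxPair → q ∈ PxPair :=
    fun p q _ h2 hp => plusPin_mono h2 hp
  have hPy_mono : ∀ p q : SpinConfig (Site 2) × SpinConfig (Site 2), q.1 ≤ p.1 → p.2 ≤ q.2 → p ∈ PyPair → q ∈ PyPair :=
    fun p q h1 _ hp => minusPin_anti h1 hp
  have hfkg1 := prod_measureReal_inter_ge_of_antitone_monotone hβ hβ hμ hμt hμ'G hμ't hCmpm hPxPairm hCmp_mono hPx_mono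
  have hfkg2 := prod_measureReal_inter_ge_of_antitone_monotone hβ hβ hμ hμt hμ'G hμ't (hCmpm.inter hPxPairm) hPyPairm
    (fun p q h1 h2 hp => ⟨hCmp_mono p q h1 h2 hp.1, hPx_mono p q h1 h2 hp.2⟩) hPy_mono
  have hmargx : (μ.prod μ').real PxPair = μ'.real Px := by
    rw [hPxPair, measureReal_def, measureReal_def,
      show {p : SpinConfig (Site 2) × SpinConfig (Site 2) | p.2 ∈ Px} = Set.univ ×ˢ Px by ext p; simp [Set.mem_prod],
      Measure.prod_prod, measure_univ, one_mul]
  have hmargy : (μ.prod μ').real PyPair = μ.real Py := by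
    rw [hPyPair, measureReal_def, measureReal_def,
      show {p : SpinConfig (Site 2) × SpinConfig (Site 2) | p.1 ∈ Py} = Py ×ˢ Set.univ by ext p; simp [Set.mem_prod],
      Measure.prod_prod, measure_univ, mul_one]
  -- (3) the almost-sure inclusion
  have key1 : ∀ᵐ ω ∂μ, ((∃ j : ℤ, ω ∈ R j \ R (j + 1)) ∧
      (∃ yC, (siteCluster (zdGraph 2) (spinSites (-1) ω ∩ halfPlane 0) yC).Infinite) ∧
      (∃ x₀, ∀ n : ℕ, ∃ k : ℤ, k < -(n : ℤ) ∧ (![k, 0] : Site 2) ∈ siteCluster zdStarGraph (spinSites 1 ω ∩ halfPlane 0) x₀)) ∧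
      ((∀ x₀ y₁ y₂, (siteCluster zdStarGraph (spinSites 1 ω ∩ halfPlane 0) x₀).Infinite →
          (siteCluster (zdGraph 2) (spinSites (-1) ω ∩ halfPlane 0) y₁).Infinite →
          (siteCluster (zdGraph 2) (spinSites (-1) ω ∩ halfPlane 0) y₂).Infinite →
          siteCluster (zdGraph 2) (spinSites (-1) ω ∩ halfPlane 0) y₁ = siteCluster (zdGraph 2) (spinSites (-1) ω ∩ halfPlane 0) y₂) ∧
        (∀ x₁ x₂ y₀, (siteCluster zdStarGraph (spinSites 1 ω ∩ halfPlane 0) x₁).Infinite →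
          (siteCluster zdStarGraph (spinSites 1 ω ∩ halfPlane 0) x₂).Infinite →
          (siteCluster (zdGraph 2) (spinSites (-1) ω ∩ halfPlane 0) y₀).Infinite →
          siteCluster zdStarGraph (spinSites 1 ω ∩ halfPlane 0) x₁ = siteCluster zdStarGraph (spinSites 1 ω ∩ halfPlane 0) x₂) ∧
        (∀ x₀ y₀, (siteCluster zdStarGraph (spinSites 1 ω ∩ halfPlane 0) x₀).Infinite →
          (siteCluster (zdGraph 2) (spinSites (-1) ω ∩ halfPlane 0) y₀).Infinite →
          (∀ a k : ℤ, (![a, 0] : Site 2) ∈ siteCluster zdStarGraph (spinSites 1 ω ∩ halfPlane 0) x₀ →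
              (![k, 0] : Site 2) ∈ siteCluster (zdGraph 2) (spinSites (-1) ω ∩ halfPlane 0) y₀ → a < k) ∨
            (∀ a k : ℤ, (![a, 0] : Site 2) ∈ siteCluster zdStarGraph (spinSites 1 ω ∩ halfPlane 0) x₀ →
              (![k, 0] : Site 2) ∈ siteCluster (zdGraph 2) (spinSites (-1) ω ∩ halfPlane 0) y₀ → k < a)) ∧
        (∀ y₀, (siteCluster (zdGraph 2) (spinSites (-1) ω ∩ halfPlane 0) y₀).Infinite →
          ∀ n : ℕ, ∃ z ∈ siteCluster (zdGraph 2) (spinSites (-1) ω ∩ halfPlane 0) y₀, z 1 = 0 ∧ (n : ℤ) < |z 0|)) := by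
    filter_upwards [hexists, hC, hL, ae_minus_cluster_unique hβc hμ, ae_plusStar_cluster_unique hβc hμ,
      ae_plusStar_minus_sides hβc hμ, ae_minus_touches_axis_io (G := zdGraph 2) hβc le_rfl zdGraph_le_zdStarGraph hμ]
      with ω h1 h2 h3 h4 h5 h6 h7
    exact ⟨⟨h1, h2, h3⟩, h4, h5, h6, h7⟩
  have hae1 := (Measure.quasiMeasurePreserving_fst (μ := μ) (ν := μ')).ae key1
  have key2 : ∀ᵐ ω ∂μ', (∀ x₁ x₂ y₀, (siteCluster zdStarGraph (spinSites 1 ω ∩ halfPlane 0) x₁).Infinite →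
        (siteCluster zdStarGraph (spinSites 1 ω ∩ halfPlane 0) x₂).Infinite →
        (siteCluster (zdGraph 2) (spinSites (-1) ω ∩ halfPlane 0) y₀).Infinite →
        siteCluster zdStarGraph (spinSites 1 ω ∩ halfPlane 0) x₁ = siteCluster zdStarGraph (spinSites 1 ω ∩ halfPlane 0) x₂) ∧
      (∃ yC, (siteCluster (zdGraph 2) (spinSites (-1) ω ∩ halfPlane 0) yC).Infinite) := by
    filter_upwards [ae_plusStar_cluster_unique hβc hμ'G, ae_exists_infinite_minusCluster_map_configShift (μ := μ) (s : ℤ) hC]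
      with ω h1 h2
    exact ⟨h1, h2⟩
  have hae2 := (Measure.quasiMeasurePreserving_snd (μ := μ) (ν := μ')).ae key2
  have hincl : ∀ᵐ p ∂(μ.prod μ'), p ∈ Cmp ∩ PxPair ∩ PyPair → p ∈ U := by
    filter_upwards [hae1, hae2] with p h1 h2 hp
    obtain ⟨⟨⟨j₀, hj₀, hj₀'⟩, ⟨yC, hyC⟩, ⟨x₀, hLω⟩⟩, huniqC, huniqD, hsides, htouchC⟩ := h1
    obtain ⟨huniqD', ⟨yC', hyC'⟩⟩ := h2
    obtain ⟨⟨⟨j, hp1, hp2⟩, hpx⟩, hpy⟩ := hp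
    set ω := p.1 with hω
    set ω' := p.2 with hω'
    -- the last axis site `a` of the first layer
    obtain ⟨a, hja, hDinf⟩ := hj₀
    have hamax : ∀ k : ℤ, (siteCluster zdStarGraph (spinSites 1 ω ∩ halfPlane 0) ![k, 0]).Infinite → k ≤ a := by
      intro k hk
      by_contra hlt
      exact hj₀' ⟨k, by omega, hk⟩
    -- the first layer's `+∗`cluster `D` through `(a, 0)`
    have haD : (![a, 0] : Site 2) ∈ siteCluster zdStarGraph (spinSites 1 ω ∩ halfPlane 0) ![a, 0] :=
      (mem_siteCluster_self_iff _ _ _).2 hDinf.nonempty.some_mem.1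
    have hmax : ∀ k : ℤ, (![k, 0] : Site 2) ∈ siteCluster zdStarGraph (spinSites 1 ω ∩ halfPlane 0) ![a, 0] → k ≤ a := by
      intro k hk
      refine hamax k ?_
      rw [siteCluster_eq_of_mem ((mem_siteCluster_self_iff _ _ _).2 hk.2.1) hk]; exact hDinf
    -- `D` touches on the left: it is the cluster of `x₀`
    have hx₀inf := infinite_of_axis_unbounded_below hLω
    have hDx₀ : siteCluster zdStarGraph (spinSites 1 ω ∩ halfPlane 0) x₀ = siteCluster zdStarGraph (spinSites 1 ω ∩ halfPlane 0) ![a, 0] :=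
      huniqD x₀ _ yC hx₀inf hDinf hyC
    have hside : ∀ y₀, (siteCluster (zdGraph 2) (spinSites (-1) ω ∩ halfPlane 0) y₀).Infinite →
        ∀ b k : ℤ, (![b, 0] : Site 2) ∈ siteCluster zdStarGraph (spinSites 1 ω ∩ halfPlane 0) ![a, 0] →
          (![k, 0] : Site 2) ∈ siteCluster (zdGraph 2) (spinSites (-1) ω ∩ halfPlane 0) y₀ → b < k := by
      intro y₀ hy₀
      rcases hsides (![a, 0]) y₀ hDinf hy₀ with h | h
      · exact h
      · exfalso
        obtain ⟨zk, hzk, hzk1, -⟩ := htouchC y₀ hy₀ 0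
        have hk : (![zk 0, 0] : Site 2) ∈ siteCluster (zdGraph 2) (spinSites (-1) ω ∩ halfPlane 0) y₀ := by
          rw [← eq_axis_of_apply_one hzk1]; exact hzk
        obtain ⟨b, hb, hbD⟩ := hLω (zk 0).natAbs
        rw [hDx₀] at hbD
        have := h b (zk 0) hbD hk
        omega
    -- the second layer's cluster through `(k', 0)`, `k' ≥ j ≥ a`
    obtain ⟨k', hjk', hinf'⟩ := hp2
    have hak' : a ≤ k' := by
      have : ¬ (j + 1 ≤ a) := fun h => hp1 ⟨a, h, hDinf⟩
      omega
    have ha'D' : (![k', 0] : Site 2) ∈ siteCluster zdStarGraph (spinSites 1 ω' ∩ halfPlane 0) ![k', 0] :=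
      (mem_siteCluster_self_iff _ _ _).2 hinf'.nonempty.some_mem.1
    obtain ⟨z, hz, z', hz', hzz'⟩ := touch_of_le_maxAxis hDinf haD hmax hside htouchC hinf' ha'D' hak'
    -- the pinning walks
    obtain ⟨z₁, hinf₁, w₁, hw₁⟩ := hpx
    obtain ⟨z₂, hinf₂, w₂, hw₂⟩ := hpy
    set C := siteCluster (zdGraph 2) (spinSites (-1) ω ∩ halfPlane 0) ![a + 1, 0] with hCdef
    have hCinf : C.Infinite := infinite_minusCluster_succ_of_isMaxAxis hDinf haD hmax
    -- identify the clusters reached by the pinning walks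
    have hz₁self : z₁ ∈ siteCluster zdStarGraph (spinSites 1 ω' ∩ halfPlane 0) z₁ :=
      (mem_siteCluster_self_iff _ _ _).2 hinf₁.nonempty.some_mem.1
    have hz₂self : z₂ ∈ siteCluster (zdGraph 2) (spinSites (-1) ω ∩ halfPlane 0) z₂ :=
      (mem_siteCluster_self_iff _ _ _).2 hinf₂.nonempty.some_mem.1
    have hD'eq : siteCluster zdStarGraph (spinSites 1 ω' ∩ halfPlane 0) z₁ = siteCluster zdStarGraph (spinSites 1 ω' ∩ halfPlane 0) ![k', 0] :=
      huniqD' z₁ _ yC' hinf₁ hinf' hyC'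
    have hCeq : siteCluster (zdGraph 2) (spinSites (-1) ω ∩ halfPlane 0) z₂ = C := huniqC (![a, 0]) z₂ _ hDinf hinf₂ hCinf
    have hz1 : z ∈ siteCluster zdStarGraph (spinSites 1 ω' ∩ halfPlane 0) z₁ := by rw [hD'eq]; exact hz
    have hz'2 : z' ∈ siteCluster (zdGraph 2) (spinSites (-1) ω ∩ halfPlane 0) z₂ := by rw [hCeq]; exact hz'
    obtain ⟨q₁, hq₁⟩ := exists_walk_of_mem_siteCluster hz₁self hz1
    obtain ⟨q₂, hq₂⟩ := exists_walk_of_mem_siteCluster hz'2 hz₂self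
    -- the bridge between `z` and `z'`
    have hbridge : ∃ b : zdStarGraph.Walk z z', ∀ v ∈ b.support, v = z ∨ v = z' := by
      rcases hzz' with rfl | hadj
      · exact ⟨Walk.nil, fun v hv => by simp at hv; exact Or.inl hv⟩
      · exact ⟨Walk.cons (zdGraph_le_zdStarGraph hadj) Walk.nil, fun v hv => by simpa using hv⟩
    obtain ⟨b, hb⟩ := hbridge
    -- goodness of the various sites
    have hgood_plus : ∀ v, ω' v = 1 → ω v ≤ ω' v := fun v hv => by rw [hv]; exact intUnits_le_one _
    have hgood_minus : ∀ v, ω v = -1 → ω v ≤ ω' v := fun v hv => by rw [hv]; exact neg_one_le_intUnits _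
    refine ⟨w₁.append (q₁.append (b.append ((q₂.mapLe zdGraph_le_zdStarGraph).append w₂.reverse))), fun v hv => ?_⟩
    rw [Walk.mem_support_append_iff, Walk.mem_support_append_iff, Walk.mem_support_append_iff,
      Walk.mem_support_append_iff, Walk.support_mapLe_eq_support, Walk.support_reverse, List.mem_reverse] at hv
    rcases hv with hv | hv | hv | hv | hv
    · exact ⟨hgood_plus v (hw₁ v hv).1, (hw₁ v hv).2⟩
    · have h := hq₁ v hv
      exact ⟨hgood_plus v h.1, hQ v h.2⟩
    · rcases hb v hv with rfl | rfl
      · exact ⟨hgood_plus _ hz.2.1.1, hQ _ hz.2.1.2⟩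
      · exact ⟨hgood_minus _ hz'.2.1.1, hQ _ hz'.2.1.2⟩
    · have h := hq₂ v hv
      exact ⟨hgood_minus v h.1, hQ v h.2⟩
    · have h := hw₂ v hv
      exact ⟨hgood_minus v h.1, h.2⟩
  -- (4) combine
  have hmono : (μ.prod μ').real (Cmp ∩ PxPair ∩ PyPair) ≤ (μ.prod μ').real U := by
    rw [measureReal_def, measureReal_def]
    exact ENNReal.toReal_mono (measure_ne_top _ _) (measure_mono_ae hincl)
  have hc₀ : ((1 - (1 + ENNReal.ofReal (Real.exp (-(8 * |β|)) / 2))⁻¹) / 2).toReal ≤ (μ.prod μ').real Cmp := by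
    rw [measureReal_def]
    exact ENNReal.toReal_mono (measure_ne_top _ _) h1
  have hc₀0 : 0 ≤ ((1 - (1 + ENNReal.ofReal (Real.exp (-(8 * |β|)) / 2))⁻¹) / 2).toReal := ENNReal.toReal_nonneg
  rw [hmargx] at hfkg1
  rw [hmargy] at hfkg2
  calc ((1 - (1 + ENNReal.ofReal (Real.exp (-(8 * |β|)) / 2))⁻¹) / 2).toReal * cP * cP
      ≤ (μ.prod μ').real Cmp * μ'.real Px * μ.real Py :=
        mul_le_mul (mul_le_mul hc₀ hpinx hcP measureReal_nonneg) hpiny hcP (mul_nonneg measureReal_nonneg measureReal_nonneg)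
    _ ≤ (μ.prod μ').real (Cmp ∩ PxPair) * μ.real Py := mul_le_mul_of_nonneg_right hfkg1 measureReal_nonneg
    _ ≤ (μ.prod μ').real (Cmp ∩ PxPair ∩ PyPair) := hfkg2
    _ ≤ (μ.prod μ').real U := hmono

end Main

end Literature.Probability.LatticeModels
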